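import Summits.QuantumFields.YangMills.Theorems.UnitScaleTiltProp7AxialResidualFreedom
import HarnessLib

/-!
# Route `UnitScaleTilt`, crux K1 child «MinimiserStabilityRegPr» (stmt-QuantumFields-19200), registered stub `stub_halvingStep` (H, skeleton v10) —
# pillar P1♭ `core` (WANTED №g26-5 «Thm 2♭ on T³»), LEAD-H T2♭-PLAN v1.1 (memo 475b767a8a928ba2) **junction J3 (HYPOTHESES♭): THE FLAT PRE-GAUGE**
# — the hypotheses (1.33)∕(1.34)∕(1.35)→(1.66) of [Balaban1985RegularSpaces] Theorem 4 AT BACKGROUND `U₀ = 1` for a printed-regular fine field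
# `U ∈ 𝔘_k(ε₀)` ([Balaban1985Variational] (2)), read on the `ℤᵈ` carriers of pub-ymgap's N05 machine (`B8Ineq132.InAk`, `B8Eq119TwistedAxial.InAx`,
# `B7Prop2Explicit.avgIter`, the tower of cubes `B8Ineq130.tlo∕thi`), pulled back at the base point `0`.

Cell `ym3-torus`, width seat `ym-ust-20520-w5` (gen 5).  `--supports stmt-QuantumFields-19200 --as helper`; THEOREMS ONLY (0 `def`, 0 `sorry`); count-neutral;
nothing here claims the stub, the crux, d = 4 or the mass gap — YM₃ on T³ is a ladder rung (R3), not the Clay problem.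

THE PRINT.  [Balaban1985RegularSpaces] p. 82: «U₀ ∈ 𝔄_k({Ω_j}, α₀) (1.33) … U′U₀ ∈ 𝔄_k({Ω_j}, α₀) ∩ Ax_k(𝔅_k, U₀), (1.34)  |(\overline{U′U₀})ʲ − Ū₀ʲ| < α₁ on Λ_j,
j = 0, 1, …, k. (1.35)»; p. 87: «Thus the conditions (1.33)–(1.35) imply |(\overline{U′U₀})ʲ − Ū₀ʲ| = |Ũ′ʲ − 1| < 11d²α₀ + α₁ on Ω_j^{(j)} (1.65) … so we assume that
|(\overline{U′U₀})ʲ − Ū₀ʲ| = |Ũ′ʲ − 1| < α₁ on Ω_j^{(j)}, j = 0, 1, …, k. (1.66)»; p. 88: «Theorem 4. There exists a constant c₁ such that for arbitrary U₀, U′U₀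
satisfying (1.33), (1.34), (1.66) with α₀ + α₁ ≤ c₁ there exists exactly one gauge transformation u satisfying (1.29) and such that the conditions (1.37),
(1.38), (1.62) hold for the configuration U₁ = U′^{u⁻¹}.»  [Balaban1985Variational] Sect. F p. 300 applies Theorem 2∕4 at the FLAT background to the regular field
`U′_k` («we fix the axial gauge … (144)–(147) … Theorem 2 of [14] … (152)»): every size there is `O(B₁Mε₀)`.

WHAT IS PROVED (sorry-free, no definition; `k := K − n`, `U♯ := pull (unitsField (toUField U)) 0` the periodic `ℤ³` pullback based at `0`).
* §1 (`ℤᵈ`, any complete normed `ℂ`-algebra `𝔸` with `‖1‖ = 1`, any `AvgClosed` gauge group `G`, `L ≥ 2`, `d ≥ 1`): `l1_mono`, `l1_lowPart_sub_le` (lattice bookkeeping),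
  `pdev_one_lt`, `inAk_of_univ`, `norm_axialTop_sub_one_le` (the tree gauge of a box makes every bond of the box `l1(hi − lo)·a`-close to `1` under the LOCAL plaquette
  hypothesis — [Balaban1985Averaging] p. 24∕[Balaban1985RegularSpaces] (1.25) via ✓`B8Lemma1NonAbelian.axial_bond_bound_sharp`), `inAx_one_of_global15`
  ((1.15) between all consecutive levels ⟹ `Ax_m(ℭ, 1)` for every `m ≤ k` and every family `ℭ`), and ★★ **`exists_topAxial_pinned_zd`**: for a `G`-valued
  `N·Lᵏ`-periodic `W` with `sup_p |W(∂p) − 1| < α·L^{−2k}` (`α` Prop.-1∕2-small) and a top box `[lo, hi]` that does not wrap (`hi − lo < N`), there is a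
  `G`-valued `N·Lᵏ`-periodic gauge transformation `g` with: `W^{g}` `G`-valued with the same plaquette deviation; **(1.15) between ALL consecutive levels at every
  block** (`\overline{W^g}ʲ(Γ_{Lz,x}) = 1`); the TOP average `\overline{W^g}ᵏ` in the tree gauge of the box (`= 1` on its tree bonds, `l1(hi − lo)·2α`-close to `1`
  on every bond of the box); and **(1.66) at background `1` on the whole tower of cubes below the box**: `|\overline{W^g}^{k−n}_b − 1| < 11d²α + 2·l1(hi − lo)·α`
  (✓`B8Ineq165Descent.ineq165_global` at `U₀ = 1`).  Construction: ✓`Prop7AxialResidualFreedom.topData_global` (pinned twisted fix `ptw L 1 W k` × the residual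
  top freedom) with the TOP DATUM `c :=` the tree gauge `axialFn W̄ᵏ lo` of `W̄ᵏ = avgIter L W k`, PERIODISED off the box by the componentwise remainder mod `N`
  (inline; so `topData_periodic` applies and `c = axialFn W̄ᵏ lo` ON the box); covariance ✓`B7AvgGaugeCovariance.avgIter_gaugeAct_top`; [Balaban1985Averaging]
  Prop. 2 ✓`pdev_avgIter_lt_two_alpha` (`pdev W̄ᵏ < 2α`).
* §2 (the T³ member `F.P K`, `SU(2)`): ★★★ **`exists_preGauge_flat`** — for `U` with `RegPr F n K ε₀ U` ([Balaban1985Variational] (2), BOTH clauses, the WHOLE torus)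
  and a non-wrapping top box `[lo, hi]` (`hi − lo < sitesPerDir k`), there is an `SU(2)` torus gauge transformation `g` such that `U′ := (U^g)♯` satisfies:
  (a) `U′ ∈ 𝔄_k(α₀ := ε₀)` on all of `ℤ³` (✓`Prop7AxialReprPrint.inAk_pull_of_regPr` + gauge invariance ✓`regPr_gaugeAct_iff`) — (1.34)-𝔄 and, `1 ∈ 𝔄_k`
  trivially, (1.33); (b) (1.15) between all consecutive levels at every block, (b′) hence `U′ ∈ Ax_m(ℭ, 1)` for every `m ≤ k` and every `ℭ` — (1.34)-Ax;
  (c′)(c) the top average is in the tree gauge of the box, `4·l1(hi − lo)·ε₀`-close to `1` there; (d) **(1.66)∕(1.35) at background `1`**: for every depth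
  `n ≤ k` and every bond of the depth-`n` cube below the box, `|\overline{U′}^{k−n}_b − 1| < 22d²ε₀ + 4·l1(hi − lo)·ε₀` — at `n = k` the fine bonds (Theorem 4's
  `h66`∕`avgClose166` rows of N05's `zdGF` for any `Ω_j` inside the tower).  NO fibre∕ℰp input: every size comes from `RegPr ε₀` alone and is `O(ε₀)`, exactly
  print's Sect. F regime; the ℰp-datum junction (o) is J4's.  The no-wrap clause is the «SMALL MEMBERS» caveat of T2♭-PLAN v1.1 §3.

HONEST SCOPE.  A knit of landed `ℤᵈ`∕torus gauge algebra and [Balaban1985Averaging] Props 1–2 ∕ [Balaban1985RegularSpaces] Lemma 1 as certified in the tree; nothing of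
Theorem 4 ∕ Proposition 5 ∕ Theorem 2 is proved; no numerics; registry untouched.

References: T. Bałaban, CMP **99** (1985) 75–102 [Balaban1985RegularSpaces] ((1.7) p.77, (1.14)–(1.15) p.78, (1.19) p.79, Lemma 1 (1.25) p.79, (1.33)–(1.35) p.82,
(1.65)–(1.66) p.87, Thm 4 p.88); CMP **98** (1985) 17–51 [Balaban1985Averaging] ((8), (11) p.19, pp.24–25, Prop. 2 (52)–(54) p.26); CMP **102** (1985) 277–309
[Balaban1985Variational] ((2) p.278, (144)–(147) p.300, (152) p.301).
-/

set_option autoImplicit false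

noncomputable section

namespace Summit.QuantumFields.YangMills.Theorems.P1FlatCorePreGauge

open NormedSpace
open Literature.MathematicalPhysics.QuantumFieldTheory.Balaban1983to89
open B7Prop1Explicit renaming Site → LSite
open B7Prop1Explicit (gaugeAct axialFn boxVec e e_apply U1 l1 hol plaqWord)
open B7Prop2Explicit (avgIter pdev C0 c2' AvgClosed le_pdev pdev_nonneg avgIter_mem)
open B7AvgGaugeCovariance (uLev uLev_apply avgIter_gaugeAct_top pdev_gaugeAct pdev_avgIter_lt_two_alpha)
open B8Ineq130 (tlo thi axialFn_one hol_one)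
open B8Ineq132 (InAk InAxOne avgIter_one Under)
open B8Eq115GaugeFixing (gaugeAct_mem_of)
open B8Eq119TwistedAxial (InAx inAx_one_iff)
open B8Eq166ConstraintPair (pinnedGauge ptw)
open B8Ineq165Descent (ineq165_global)
open B8Lemma1NonAbelian (lowPart lowPart_nonneg lowPart_le_self e_nonneg axial_bond_bound_sharp axial_treeBond_eq_one)
open B8Eq131Cubes (flm)
open B12Ineq417Flat (shiftCfg shiftCfg_apply)
open Summit.QuantumFields.YangMills.Theorems.Prop7AxialResidualFreedom (topData_global topData_periodic)

variable {d : ℕ}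

/-! ## §1 `ℤᵈ`: the top tree gauge, periodised, on the pinned twisted fix at background `1` -/

section Zd

variable {𝔸 : Type*} [NormedRing 𝔸] [NormOneClass 𝔸] [NormedAlgebra ℂ 𝔸] [CompleteSpace 𝔸]

omit [NormOneClass 𝔸] [NormedAlgebra ℂ 𝔸] [CompleteSpace 𝔸] in
/-- `l1` is monotone on the positive cone of `ℤᵈ`. [folklore] -/
theorem l1_mono {v w : LSite d} (hv : 0 ≤ v) (hvw : v ≤ w) : l1 v ≤ l1 w := by
  unfold l1
  refine Finset.sum_le_sum fun κ _ => ?_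
  have h0 : 0 ≤ v κ := hv κ
  have h1 : v κ ≤ w κ := hvw κ
  have h2 : 0 ≤ w κ := h0.trans h1
  zify
  rw [abs_of_nonneg h0, abs_of_nonneg h2]
  exact h1

omit [NormOneClass 𝔸] [NormedAlgebra ℂ 𝔸] [CompleteSpace 𝔸] in
/-- For a bond `⟨x, x + e_ν⟩` of the box `[lo, hi]`, the part of `x − lo` below `ν` has `l1`-length at most `l1 (hi − lo)`. [folklore] -/
theorem l1_lowPart_sub_le {lo hi x : LSite d} (ν : Fin d) (hx : lo ≤ x) (hxν : x + e ν ≤ hi) :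
    l1 (lowPart ν (x - lo)) ≤ l1 (hi - lo) := by
  have h0 : 0 ≤ x - lo := sub_nonneg.mpr hx
  have hx' : x ≤ hi := fun κ => by
    have h1 := hxν κ
    have h2 : (0 : ℤ) ≤ e ν κ := e_nonneg ν κ
    simp only [Pi.add_apply] at h1
    linarith
  exact (l1_mono (lowPart_nonneg ν h0) (lowPart_le_self ν h0)).trans (l1_mono h0 (sub_le_sub_right hx' lo))

omit [NormOneClass 𝔸] [NormedAlgebra ℂ 𝔸] [CompleteSpace 𝔸] in
/-- The trivial configuration has no plaquette deviation: `pdev 1 < b` for every `b > 0`. [folklore] -/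
theorem pdev_one_lt {b : ℝ} (hb : 0 < b) : pdev (1 : LSite d → Fin d → 𝔸ˣ) < b := by
  have h : pdev (1 : LSite d → Fin d → 𝔸ˣ) ≤ 0 := by
    unfold pdev
    refine Real.iSup_le (fun p => ?_) le_rfl
    rw [hol_one, Units.val_one, sub_self, norm_zero]
  exact h.trans_lt hb

omit [NormedAlgebra ℂ 𝔸] [CompleteSpace 𝔸] in
/-- **THE TREE GAUGE OF A BOX** ([Balaban1985Averaging] p. 24 «V₀(x, x + e₁) = 1, |V₀(x, x + e₂) − 1| < |x₁ − y₁|α₀, …»): under the LOCAL plaquette hypothesis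
`|V(∂p) − 1| ≤ a` on `[lo, hi]`, every bond of the box is `l1(hi − lo)·a`-close to `1` in the tree (axial) gauge based at `lo`.
[cite: Balaban1985Averaging, pp.24-25; Balaban1985RegularSpaces, Lemma 1 (1.25) p.79] -/
theorem norm_axialTop_sub_one_le (V : LSite d → Fin d → 𝔸ˣ) (hV : ∀ x κ, V x κ ∈ U1 𝔸) {lo hi : LSite d} {a : ℝ} (ha : 0 ≤ a)
    (hP : B8Lemma1NonAbelian.PlaqSmall V lo hi a) (x : LSite d) (ν : Fin d) (hx : lo ≤ x) (hxν : x + e ν ≤ hi) :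
    ‖((gaugeAct (axialFn V lo) V x ν : 𝔸ˣ) : 𝔸) - 1‖ ≤ l1 (hi - lo) * a := by
  refine (axial_bond_bound_sharp V hV hP lo x ν le_rfl hx hxν).trans ?_
  exact mul_le_mul_of_nonneg_right (by exact_mod_cast l1_lowPart_sub_le ν hx hxν) ha

omit [NormOneClass 𝔸] in
/-- **(1.15) BETWEEN ALL CONSECUTIVE LEVELS GIVES `Ax_m(ℭ, 1)` FOR EVERY `m ≤ k` AND EVERY FAMILY `ℭ`** (the class form N05's `zdGF.InAAx` reads at background `1`:
`∀ m ≤ k, InAx L m (Λs m) 1 W`). [cite: Balaban1985RegularSpaces, (1.15) p.78, (1.19) p.79, (1.34) p.82] -/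
theorem inAx_one_of_global15 {L k : ℕ} {W : LSite d → Fin d → 𝔸ˣ}
    (h15 : ∀ n, n < k → ∀ (z : LSite d) (r : Fin d → Fin L),
      axialFn (avgIter L W (k - (n + 1))) ((L : ℤ) • z) ((L : ℤ) • z + boxVec L r) = 1) :
    ∀ m, m ≤ k → ∀ Λ : ℕ → Set (LSite d), InAx L m Λ (1 : LSite d → Fin d → 𝔸ˣ) W := by
  intro m hm Λ
  rw [inAx_one_iff]
  intro j _ hjm xj _ n hn z _ r
  have h := h15 (k - (n + 1)) (by omega) z r
  rwa [show k - (k - (n + 1) + 1) = n by omega] at h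

omit [NormOneClass 𝔸] [CompleteSpace 𝔸] in
/-- The all-lattice class `𝔄_k(α)` (`Ω_j = ℤᵈ` for every `j`) restricts to `𝔄_k({Ω_j}, α)` for every region sequence (`B8Ineq132.condAt_anti`) — the form
N05's `zdGF.InA`∕`InAAx` read on a member's `Ω`. [cite: Balaban1985RegularSpaces, (1.7)-(1.9) p.77] -/
theorem inAk_of_univ {L k : ℕ} {η α : ℝ} {V : LSite d → Fin d → 𝔸ˣ}
    (h : InAk L k η α (fun _ => (Set.univ : Set (LSite d))) V) (Ω : ℕ → Set (LSite d)) : InAk L k η α Ω V :=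
  fun j hj => B8Ineq132.condAt_anti (Set.subset_univ _) (h j hj)

/-- ★★ **THE FLAT PRE-GAUGE ON `ℤᵈ`: PINNED TWISTED FIX AT BACKGROUND `1` WITH THE TOP LEVEL IN THE (PERIODISED) TREE GAUGE OF A BOX.**  For an `AvgClosed`
group `G`, `L ≥ 2`, `d ≥ 1`, a `G`-valued `N·Lᵏ`-periodic `W` with `sup_p |W(∂p) − 1| < α·L^{−2k}` (`C₀α ≤ ⅓`, `2α ≤ c₂′`), and a top box `lo ≤ hi` with `hi − lo < N`
componentwise and `11d²α + 2·l1(hi − lo)·α ≤ 1∕6`, and any constant frame `c₀ ∈ G`, there is a `G`-valued `N·Lᵏ`-periodic `g` with `W^g` `G`-valued,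
`pdev W^g = pdev W`, (1.15) between all consecutive levels at every block, TOP VALUES `g(Lᵏz) = c₀·(tree gauge of W̄ᵏ at lo)(z)` on the box (so the top average
is the `c₀`-conjugate of the tree-gauged `W̄ᵏ`: `= 1` on the tree bonds of the box and `l1(hi − lo)·2α`-close to `1` on the box), and (1.66) at background `1`
on the tower below the box: `|\overline{W^g}^{k−n}_b − 1| < 11d²α + 2·l1(hi − lo)·α` for `b = ⟨x, x + e_ν⟩`, `Lⁿ·lo ≤ x`, `x + e_ν ≤ Lⁿ(hi + 𝟙) − 𝟙`.
[cite: Balaban1985RegularSpaces, (1.15) p.78, (1.19) p.79, (1.65)-(1.66) p.87; Balaban1985Averaging, (11) p.19, pp.24-25, Prop. 2 (54) p.26] -/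
theorem exists_topAxial_pinned_zd (L : ℕ) (hL : 2 ≤ L) (hd : 1 ≤ d) {G : Subgroup 𝔸ˣ} (hG : AvgClosed d L G) (k N : ℕ)
    (W : LSite d → Fin d → 𝔸ˣ) (hW : ∀ x κ, W x κ ∈ G) {α : ℝ} (hα : 0 < α) (hα3 : C0 d * α ≤ 1 / 3) (hα2 : 2 * α ≤ c2' d L)
    (h34 : pdev W < α * (((L : ℝ) ^ k)⁻¹) ^ 2)
    (hWP : ∀ i : Fin d, shiftCfg (((N * L ^ k : ℕ) : ℤ) • e i) W = W)
    (lo hi : LSite d) (hwrap : ∀ i, hi i - lo i < N) (hsmall : 11 * (d : ℝ) ^ 2 * α + l1 (hi - lo) * (2 * α) ≤ 1 / 6)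
    (c₀ : 𝔸ˣ) (hc₀ : c₀ ∈ G) :
    ∃ g : LSite d → 𝔸ˣ, (∀ x, g x ∈ G) ∧ (∀ (x : LSite d) (i : Fin d), g (x + ((N * L ^ k : ℕ) : ℤ) • e i) = g x) ∧
      (∀ x κ, gaugeAct g W x κ ∈ G) ∧ pdev (gaugeAct g W) = pdev W ∧
      (∀ n, n < k → ∀ (z : LSite d) (r : Fin d → Fin L),
        axialFn (avgIter L (gaugeAct g W) (k - (n + 1))) ((L : ℤ) • z) ((L : ℤ) • z + boxVec L r) = 1) ∧
      (∀ z : LSite d, lo ≤ z → z ≤ hi → g (((L : ℤ) ^ k) • z) = c₀ * axialFn (avgIter L W k) lo z) ∧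
      (∀ (x : LSite d) (ν : Fin d), lo ≤ x → x + e ν ≤ hi →
        avgIter L (gaugeAct g W) k x ν = c₀ * gaugeAct (axialFn (avgIter L W k) lo) (avgIter L W k) x ν * c₀⁻¹) ∧
      (∀ (x : LSite d) (ν : Fin d), lo ≤ x → x + e ν ≤ hi → lowPart ν (x - lo) = 0 → avgIter L (gaugeAct g W) k x ν = 1) ∧
      (∀ (x : LSite d) (ν : Fin d), lo ≤ x → x + e ν ≤ hi →
        ‖((avgIter L (gaugeAct g W) k x ν : 𝔸ˣ) : 𝔸) - 1‖ ≤ l1 (hi - lo) * (2 * α)) ∧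
      (∀ n, n ≤ k → ∀ (x : LSite d) (ν : Fin d), tlo L lo n ≤ x → x + e ν ≤ thi L hi n →
        ‖((avgIter L (gaugeAct g W) (k - n) x ν : 𝔸ˣ) : 𝔸) - 1‖ < 11 * (d : ℝ) ^ 2 * α + l1 (hi - lo) * (2 * α)) := by
  have hL1 : 1 ≤ L := le_trans (by norm_num) hL
  have hWU : ∀ x κ, W x κ ∈ U1 𝔸 := fun x κ => hG.le_U1 (hW x κ)
  -- the top average and its plaquettes ([Balaban1985Averaging] Prop. 2)
  set Wk : LSite d → Fin d → 𝔸ˣ := avgIter L W k with hWk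
  have hWkG : ∀ x κ, Wk x κ ∈ G := fun x κ => avgIter_mem L hL hG k W hW hα hα3 hα2 h34 k le_rfl x κ
  have hWkU : ∀ x κ, Wk x κ ∈ U1 𝔸 := fun x κ => hG.le_U1 (hWkG x κ)
  have hpk : pdev Wk < 2 * α := pdev_avgIter_lt_two_alpha L hL hG k W hW hα hα3 hα2 h34 k le_rfl
  have hPk : B8Lemma1NonAbelian.PlaqSmall Wk lo hi (2 * α) := fun x κ μ _ _ _ => (le_pdev hWkU x κ μ).trans hpk.le
  -- the periodised tree gauge of the box as top datum
  set red : LSite d → LSite d := fun z i => lo i + (z i - lo i) % (N : ℤ) with hred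
  set c : LSite d → 𝔸ˣ := fun z => c₀ * axialFn Wk lo (red z) with hc
  have hcG : ∀ z, c z ∈ G := fun z => G.mul_mem hc₀ (B7Prop2Explicit.hol_mem_of hWkG _ _)
  have hc₀U : c₀ ∈ U1 𝔸 := hG.le_U1 hc₀
  have hred_per : ∀ (z : LSite d) (i : Fin d), red (z + (N : ℤ) • e i) = red z := by
    intro z i
    funext j
    simp only [hred, Pi.add_apply, Pi.smul_apply, smul_eq_mul]
    rw [show z j + (N : ℤ) * e i j - lo j = (z j - lo j) + e i j * (N : ℤ) by ring, Int.add_mul_emod_self_right]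
  have hcper : ∀ (z : LSite d) (i : Fin d), c (z + (N : ℤ) • e i) = c z := fun z i => by
    simp only [hc, hred_per]
  have hred_box : ∀ z : LSite d, lo ≤ z → (∀ i, z i ≤ hi i) → red z = z := by
    intro z hz hzhi
    funext i
    have h0 : 0 ≤ z i - lo i := sub_nonneg.mpr (hz i)
    have h1 : z i - lo i < (N : ℤ) := by have := hzhi i; have := hwrap i; omega
    simp only [hred]
    rw [Int.emod_eq_of_lt h0 h1]; ring
  have hc_box : ∀ z : LSite d, lo ≤ z → (∀ i, z i ≤ hi i) → c z = c₀ * axialFn Wk lo z := fun z hz hzhi => by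
    simp only [hc, hred_box z hz hzhi]
  -- the pinned twisted fix at background `1` with top datum `c`
  have h33 : pdev (1 : LSite d → Fin d → 𝔸ˣ) < α * (((L : ℝ) ^ k)⁻¹) ^ 2 := pdev_one_lt (by positivity)
  have h1G : ∀ x κ, (1 : LSite d → Fin d → 𝔸ˣ) x κ ∈ G := fun _ _ => G.one_mem
  obtain ⟨hgG, hWgG, htop, h19⟩ := topData_global L hL hG k 1 W h1G hW hα hα3 hα2 h33 h34 c hcG
  set g : LSite d → 𝔸ˣ := ((pinnedGauge L (1 : LSite d → Fin d → 𝔸ˣ) k)⁻¹ * (fun x => c (flm L k x)) *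
    pinnedGauge L (1 : LSite d → Fin d → 𝔸ˣ) k) * ptw L 1 W k with hg
  have hgU : ∀ x, g x ∈ U1 𝔸 := fun x => hG.le_U1 (hgG x)
  have h1P : ∀ i : Fin d, shiftCfg (((N * L ^ k : ℕ) : ℤ) • e i) (1 : LSite d → Fin d → 𝔸ˣ) = 1 := fun i => rfl
  have hgper : ∀ (x : LSite d) (i : Fin d), g (x + ((N * L ^ k : ℕ) : ℤ) • e i) = g x :=
    fun x i => topData_periodic hL1 N k h1P hWP hcper x i
  -- (1.15) between all consecutive levels
  have h15 : ∀ n, n < k → ∀ (z : LSite d) (r : Fin d → Fin L),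
      axialFn (avgIter L (gaugeAct g W) (k - (n + 1))) ((L : ℤ) • z) ((L : ℤ) • z + boxVec L r) = 1 := by
    intro n hn z r
    have h := h19 n hn z r
    rwa [avgIter_one, axialFn_one] at h
  have hpdev : pdev (gaugeAct g W) = pdev W := pdev_gaugeAct hgU W
  -- the top average is the tree gauge of the box
  have htopavg : avgIter L (gaugeAct g W) k = gaugeAct (uLev L g k) Wk := avgIter_gaugeAct_top L hL hG k W hW hgU hα hα3 hα2 h34
  have hbond : ∀ (x : LSite d) (ν : Fin d), lo ≤ x → x + e ν ≤ hi →
      avgIter L (gaugeAct g W) k x ν = c₀ * gaugeAct (axialFn Wk lo) Wk x ν * c₀⁻¹ := by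
    intro x ν hx hxν
    have hx' : ∀ i, x i ≤ hi i := fun i => by
      have h1 := hxν i
      have h2 : (0 : ℤ) ≤ e ν i := e_nonneg ν i
      simp only [Pi.add_apply] at h1
      linarith
    have hxν' : ∀ i, (x + e ν) i ≤ hi i := fun i => hxν i
    have hxν0 : lo ≤ x + e ν := fun i => by
      have h2 : (0 : ℤ) ≤ e ν i := e_nonneg ν i
      have := hx i; simp only [Pi.add_apply]; linarith
    rw [htopavg]
    simp only [gaugeAct, uLev_apply, htop, hc_box x hx hx', hc_box (x + e ν) hxν0 hxν', mul_inv_rev, mul_assoc]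
  have htopval : ∀ z : LSite d, lo ≤ z → z ≤ hi → g (((L : ℤ) ^ k) • z) = c₀ * axialFn Wk lo z :=
    fun z hz hzhi => by rw [htop z, hc_box z hz (fun i => hzhi i)]
  refine ⟨g, hgG, hgper, hWgG, hpdev, h15, htopval, hbond, fun x ν hx hxν htree => ?_, fun x ν hx hxν => ?_, fun n hn x ν hx hxν => ?_⟩
  · rw [hbond x ν hx hxν, axial_treeBond_eq_one Wk lo x ν htree, mul_one, mul_inv_cancel]
  · rw [hbond x ν hx hxν, Units.val_mul, Units.val_mul]
    exact (B7Prop1Explicit.norm_units_conj_sub_one_le hc₀U _).trans (norm_axialTop_sub_one_le Wk hWkU (by positivity) hPk x ν hx hxν)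
  · -- (1.65) → (1.66) at background `1` on the tower below the box
    have h34' : pdev (gaugeAct g W) < α * (((L : ℝ) ^ k)⁻¹) ^ 2 := by rw [hpdev]; exact h34
    have h19' : ∀ m, m < k → ∀ z, tlo L lo m ≤ z → z ≤ thi L hi m → ∀ r : Fin d → Fin L,
        axialFn (avgIter L (gaugeAct g W) (k - (m + 1))) ((L : ℤ) • z) ((L : ℤ) • z + boxVec L r) =
          axialFn (avgIter L (1 : LSite d → Fin d → 𝔸ˣ) (k - (m + 1))) ((L : ℤ) • z) ((L : ℤ) • z + boxVec L r) := by
      intro m hm z _ _ r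
      rw [avgIter_one, axialFn_one]
      exact h15 m hm z r
    have h35 : ∀ x ν, lo ≤ x → x + e ν ≤ hi →
        ‖((avgIter L (gaugeAct g W) k x ν : 𝔸ˣ) : 𝔸) - avgIter L (1 : LSite d → Fin d → 𝔸ˣ) k x ν‖ ≤ l1 (hi - lo) * (2 * α) := by
      intro x ν hx hxν
      rw [avgIter_one, Pi.one_apply, Pi.one_apply, Units.val_one, hbond x ν hx hxν, Units.val_mul, Units.val_mul]
      exact (B7Prop1Explicit.norm_units_conj_sub_one_le hc₀U _).trans (norm_axialTop_sub_one_le Wk hWkU (by positivity) hPk x ν hx hxν)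
    have hθ : 0 ≤ l1 (hi - lo) * (2 * α) := by positivity
    have h := ineq165_global L hL hd hG k 1 (gaugeAct g W) h1G hWgG hα hα3 hα2 h33 h34' lo hi h19' h35 hθ hsmall n hn x ν hx hxν
    rw [avgIter_one, Pi.one_apply, Pi.one_apply, Units.val_one] at h
    exact h.1.trans_lt h.2

end Zd

/-! ## §2 The T³ member: the flat pre-gauge of a printed-regular field, Theorem 4's hypotheses at background `1` -/

section Torus

open scoped Matrix.Norms.L2Operator
open Literature.MathematicalPhysics.QuantumFieldTheory.Balaban1983to89.T3ContinuumYM3Torus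
open Literature.MathematicalPhysics.QuantumFieldTheory.Balaban1983to89.T3PrintedRegularMinimiser (RegPr)
open Literature.MathematicalPhysics.QuantumFieldTheory.Balaban1983to89.T3PrintedRegularOrbits (regPr_gaugeAct_iff)
open B7Prop2SpecialUnitary (specialUnitaryUnits mem_specialUnitaryUnits)
open B7AvgClosedSpecialUnitarySharp (avgClosed_specialUnitary_of_le_twentyone)
open B10Eq27TorusAxialLog (transl pull pull_apply unitsField toUField)
open B8Thm2SetupTorus (pullGauge pullGauge_apply toUGauge)
open Summit.QuantumFields.YangMills.Theorems.Prop7AxialReprPrint (pull_toUField_mem pull_periodic_pow exists_su_gauge_of_periodic pull_toUField_gaugeAct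
  inAk_pull_of_regPr pdev_pull_lt)
open Summit.QuantumFields.YangMills.Theorems.Prop7FlatHolonomy (sitesPerDir_zero_eq_mul_pow)

variable (F : T3Family) {n K : ℕ}

/-- ★★★ **THE FLAT PRE-GAUGE OF A PRINTED-REGULAR FIELD — THEOREM 4's HYPOTHESES (1.33)∕(1.34)∕(1.66) AT BACKGROUND `1`** (LEAD-H T2♭-PLAN v1.1 §3 J3).  For
`U ∈ 𝔘_k(ε₀)` (`RegPr F n K ε₀ U`, [Balaban1985Variational] (2), `k = K − n`) with `ε₀` Prop.-2-small and a top box `lo ≤ hi` of the `k`-lattice not wrapping the torus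
(`hi − lo < sitesPerDir k`), there is an `SU(2)` gauge transformation `g` of the torus such that the `ℤ³` pullback `U′ := (U^g)♯` based at `0` satisfies:
(a) `U′ ∈ 𝔄_k(ε₀)` on all of `ℤ³` ((1.34)-𝔄; (1.33) is trivial at `U₀ = 1`); (a′) the TOP VALUES of `g♯` on the box are `c₀·(tree gauge of Ū♯ᵏ at lo)` for the
prescribed constant frame `c₀ ∈ SU(2)` (J4's normalisation freedom); (b) (1.15) between all consecutive levels at every block, (b′) `U′ ∈ Ax_m(ℭ, 1)` for every
`m ≤ k` and every family `ℭ` ((1.34)-Ax); (c′) the top average `\overline{U′}ᵏ` is `1` on the tree bonds of the box and (c) `4·l1(hi − lo)·ε₀`-close to `1` on every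
bond of the box; (d) (1.66)∕(1.35) at background `1`: `|\overline{U′}^{k−m}_b − 1| < 22d²ε₀ + 4·l1(hi − lo)·ε₀` on every bond `b` of the depth-`m` cube below the box,
`m ≤ k` (at `m = k`: the fine bonds).  All sizes from `RegPr ε₀` alone. [cite: Balaban1985RegularSpaces, (1.33)-(1.35) p.82, (1.65)-(1.66) p.87, Thm 4 p.88, (1.15) p.78, (1.19) p.79; Balaban1985Variational, (2) p.278, (144)-(147) p.300, (152) p.301; Balaban1985Averaging, Prop. 2 (54) p.26] -/
theorem exists_preGauge_flat (hnK : n < K) {ε₀ : ℝ} (hε₀ : 0 < ε₀)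
    (hε3 : C0 (F.P K).d * (2 * ε₀) ≤ 1 / 3) (hε2 : 2 * (2 * ε₀) ≤ c2' (F.P K).d (F.P K).L)
    {U : GaugeField (F.P K) 0 (Matrix.specialUnitaryGroup (Fin 2) ℂ)} (hU : RegPr F n K ε₀ U)
    (lo hi : LSite (F.P K).d) (hwrap : ∀ i, hi i - lo i < ((F.P K).sitesPerDir (K - n) : ℤ))
    (hsmall : 11 * ((F.P K).d : ℝ) ^ 2 * (2 * ε₀) + l1 (hi - lo) * (2 * (2 * ε₀)) ≤ 1 / 6)
    (c₀ : (Matrix (Fin 2) (Fin 2) ℂ)ˣ) (hc₀ : c₀ ∈ specialUnitaryUnits (Fin 2)) :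
    ∃ g : GaugeTransf (F.P K) 0 (Matrix.specialUnitaryGroup (Fin 2) ℂ),
      InAk (F.P K).L (K - n) (((F.L : ℝ)⁻¹) ^ (K - n)) ε₀ (fun _ => (Set.univ : Set (LSite (F.P K).d)))
        (pull (unitsField (toUField (GaugeField.gaugeAct g U))) 0) ∧
      (∀ z : LSite (F.P K).d, lo ≤ z → z ≤ hi →
        pullGauge (fun x => Unitary.toUnits (toUGauge (F.P K) 2 g x)) 0 ((((F.P K).L : ℤ) ^ (K - n)) • z) =
          c₀ * axialFn (avgIter (F.P K).L (pull (unitsField (toUField U)) 0) (K - n)) lo z) ∧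
      (∀ m, m < K - n → ∀ (z : LSite (F.P K).d) (r : Fin (F.P K).d → Fin (F.P K).L),
        axialFn (avgIter (F.P K).L (pull (unitsField (toUField (GaugeField.gaugeAct g U))) 0) (K - n - (m + 1)))
          (((F.P K).L : ℤ) • z) (((F.P K).L : ℤ) • z + boxVec (F.P K).L r) = 1) ∧
      (∀ m, m ≤ K - n → ∀ Λ : ℕ → Set (LSite (F.P K).d),
        InAx (F.P K).L m Λ (1 : LSite (F.P K).d → Fin (F.P K).d → (Matrix (Fin 2) (Fin 2) ℂ)ˣ) (pull (unitsField (toUField (GaugeField.gaugeAct g U))) 0)) ∧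
      (∀ (x : LSite (F.P K).d) (ν : Fin (F.P K).d), lo ≤ x → x + e ν ≤ hi → lowPart ν (x - lo) = 0 →
        avgIter (F.P K).L (pull (unitsField (toUField (GaugeField.gaugeAct g U))) 0) (K - n) x ν = 1) ∧
      (∀ (x : LSite (F.P K).d) (ν : Fin (F.P K).d), lo ≤ x → x + e ν ≤ hi →
        ‖((avgIter (F.P K).L (pull (unitsField (toUField (GaugeField.gaugeAct g U))) 0) (K - n) x ν : (Matrix (Fin 2) (Fin 2) ℂ)ˣ) :
            Matrix (Fin 2) (Fin 2) ℂ) - 1‖ ≤ l1 (hi - lo) * (2 * (2 * ε₀))) ∧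
      (∀ m, m ≤ K - n → ∀ (x : LSite (F.P K).d) (ν : Fin (F.P K).d), tlo (F.P K).L lo m ≤ x → x + e ν ≤ thi (F.P K).L hi m →
        ‖((avgIter (F.P K).L (pull (unitsField (toUField (GaugeField.gaugeAct g U))) 0) (K - n - m) x ν : (Matrix (Fin 2) (Fin 2) ℂ)ˣ) :
            Matrix (Fin 2) (Fin 2) ℂ) - 1‖ < 11 * ((F.P K).d : ℝ) ^ 2 * (2 * ε₀) + l1 (hi - lo) * (2 * (2 * ε₀))) := by
  letI : CStarAlgebra (Matrix (Fin 2) (Fin 2) ℂ) := B10Eq29TubeLine.cstarAlgebraMatrix 2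
  have hkm : K - n ≤ (F.P K).m + (F.P K).K := by show K - n ≤ F.m + K; omega
  have hL2 : 2 ≤ (F.P K).L := (F.P K).hL.2
  have hd1 : 1 ≤ (F.P K).d := by rw [T3Family.P_d]; norm_num
  have hG : AvgClosed (F.P K).d (F.P K).L (specialUnitaryUnits (Fin 2)) :=
    avgClosed_specialUnitary_of_le_twentyone (by norm_num) (F.P K).d (F.P K).L
  -- the based pullback and its plaquette deviation from `RegPr`
  have hWG : ∀ z κ, pull (unitsField (toUField U)) 0 z κ ∈ specialUnitaryUnits (Fin 2) := pull_toUField_mem U 0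
  have hInAk := inAk_pull_of_regPr F hε₀.le hU
  have h34 : pdev (pull (unitsField (toUField U)) 0) < (2 * ε₀) * ((((F.P K).L : ℝ) ^ (K - n))⁻¹) ^ 2 :=
    pdev_pull_lt hε₀ hInAk 0
  have h2ε : 0 < 2 * ε₀ := by positivity
  have hWP : ∀ i : Fin (F.P K).d, shiftCfg ((((F.P K).sitesPerDir (K - n) * (F.P K).L ^ (K - n) : ℕ) : ℤ) • e i)
      (pull (unitsField (toUField U)) 0) = pull (unitsField (toUField U)) 0 := fun i => pull_periodic_pow hkm _ 0 i
  obtain ⟨gz, hgzG, hgzper, -, -, h15, htopval, -, htree, htopb, htower⟩ :=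
    exists_topAxial_pinned_zd (F.P K).L hL2 hd1 hG (K - n) ((F.P K).sitesPerDir (K - n)) _ hWG h2ε hε3 hε2 h34 hWP lo hi
      hwrap hsmall c₀ hc₀
  -- descent to the torus
  have hper : ∀ (z : LSite (F.P K).d) (i : Fin (F.P K).d), gz (z + (((F.P K).sitesPerDir 0 : ℕ) : ℤ) • e i) = gz z := by
    intro z i
    rw [sitesPerDir_zero_eq_mul_pow hkm]
    exact hgzper z i
  obtain ⟨g, hg⟩ := exists_su_gauge_of_periodic hgzG hper 0
  have hpull : pull (unitsField (toUField (GaugeField.gaugeAct g U))) 0 = gaugeAct gz (pull (unitsField (toUField U)) 0) := by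
    rw [pull_toUField_gaugeAct, hg]
  refine ⟨g, ?_, ?_, ?_, ?_, ?_, ?_, ?_⟩
  · -- (1.34)-𝔄: gauge invariance of the printed-regular space
    have hreg : RegPr F n K ε₀ (GaugeField.gaugeAct g U) := (regPr_gaugeAct_iff F hε₀.le g U).mpr hU
    exact inAk_pull_of_regPr F hε₀.le hreg
  · intro z hz hzhi
    rw [hg]
    exact htopval z hz hzhi
  · intro m hm z r
    rw [hpull]
    exact h15 m hm z r
  · intro m hm Λ
    rw [hpull]
    exact inAx_one_of_global15 h15 m hm Λ
  · intro x ν hx hxν htr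
    rw [hpull]
    exact htree x ν hx hxν htr
  · intro x ν hx hxν
    rw [hpull]
    exact htopb x ν hx hxν
  · intro m hm x ν hx hxν
    rw [hpull]
    exact htower m hm x ν hx hxν

end Torus

end Summit.QuantumFields.YangMills.Theorems.P1FlatCorePreGauge

end
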